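import Summits.QuantumFields.YangMills.Theorems.UnitScaleTiltNontrivial
import Literature.MathematicalPhysics.QuantumFieldTheory.Balaban1983to89.T3LimitLawAtomless
import HarnessLib

/-!
# `UnitScaleTiltLimitLawAtomless` — the route's three cruxes give the continuum loop law CONTINUOUS (atomless) marginals at every simple-loop
# label (route `UnitScaleTilt`, rev 14; cell `ym3-torus`, seat `ym3-torus-p2` gen 15; companion of `UnitScaleTiltNontrivial(Labels)`)

WHAT THIS IS NOT: not d = 4, not infinite volume, not a mass gap, not Clay; the three cruxes `MinimiserStabilityRegPr` (19200),
`FluctuationComparisonRegPrIntL` (20520), `HistoryTailL` (19936) are HYPOTHESES, as in `Theses.UnitScaleTilt.closes`.  Composition of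
`UnitScaleTiltNontrivial.exists_refine_unitTiltTail` (the deciding theorem's refined tilt) with the cell's
`T3LimitLawAtomless.exists_osLaw_atomless_of_refine_unitTiltTail` (King's additive device on events + portmanteau): **under the three cruxes,
for every three-torus family and every `γ > 0`, the OS continuum loop law `ν` satisfies `ν{y | y_C = a} = 0` for every `a` and every label `C`
whose unit-lattice representative visits some bond exactly once** — the continuum plaquette / Polyakov / simple-loop variables have continuous
distribution functions (no two-point or lattice-valued marginals).

References: C. King, CMP 102 (1986) [King1986] (Thm 3.4 (3.13) p.657); A. Jaffe, E. Witten [JaffeWittenClay2006] (§6.5 p.11).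
-/

noncomputable section

open MeasureTheory Filter Topology Set
open Literature.MathematicalPhysics.QuantumFieldTheory.Balaban1983to89
open Literature.MathematicalPhysics.QuantumFieldTheory.Balaban1983to89.T3ContinuumYM3Torus
open Literature.MathematicalPhysics.QuantumFieldTheory.Balaban1983to89.T3UnitScaleTilt
open Literature.MathematicalPhysics.QuantumFieldTheory.Balaban1983to89.T3UnitLawDensityEML (ℰp measurableE_ℰp)
open Literature.MathematicalPhysics.QuantumFieldTheory.Balaban1983to89.T3LimitLawAtomless
open Literature.MathematicalPhysics.QuantumFieldTheory.Balaban1983to89.T4Continuum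
open Literature.MathematicalPhysics.QuantumFieldTheory.Balaban1983to89.T4LimitLaw
open Summit.QuantumFields.YangMills.Theses.UnitScaleTilt

namespace Summit.QuantumFields.YangMills.Theorems.UnitScaleTiltNontrivial

/-- **THE THREE CRUXES GIVE AN OS CONTINUUM LAW WITH ATOMLESS SIMPLE-LOOP MARGINALS**: for every family `F` and every `γ > 0` there is a law `ν`
with `IsOSContinuumLaw3 F hE hγ ν` (hence THE law, by uniqueness) such that `ν{y | y_C = a} = 0` for every `a` and every once-visiting label `C`.
[cite: JaffeWittenClay2006, §6.5 p.11] -/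
theorem osLaw_atomless_of_cruxes (h200 : MinimiserStabilityRegPr) (h201 : FluctuationComparisonRegPrIntL) (hK2 : HistoryTailL)
    (F : T3Family) {γ : ℝ} (hγ : 0 < γ) :
    ∃ ν : MeasureTheory.ProbabilityMeasure (Cube (ULoop3 F)), IsOSContinuumLaw3 F measurableE_ℰp hγ.le ν ∧
      ∀ (C : ULoop3 F) (γ₁ γ₂ : List (LStep (F.P 0) 0)) (s : LStep (F.P 0) 0), C.1.atLevel 0 = γ₁ ++ s :: γ₂ →
        (∀ s' ∈ γ₁, s'.bond ≠ s.bond) → (∀ s' ∈ γ₂, s'.bond ≠ s.bond) →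
          ∀ a : ℝ, (ν : Measure (Cube (ULoop3 F))) {y | ((y C : Set.Icc (-1 : ℝ) 1) : ℝ) = a} = 0 := by
  obtain ⟨n, r, w, w', hr, hw, hw', h⟩ := exists_refine_unitTiltTail h200 h201 hK2 F hγ
  exact exists_osLaw_atomless_of_refine_unitTiltTail F n hγ.le h hr hw hw'

end Summit.QuantumFields.YangMills.Theorems.UnitScaleTiltNontrivial

end
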